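import Summits.MatrixMultiplication.MatrixMultiplication.Theses.WindowedCompletionRank
import Literature.Computability.AlgebraicComplexity.MatMulMonomialSubrank

/-!
# MatrixMultiplication / DesignFlattening — `GrowingHostDesigns`, line `birth`: the window bridge of the canonical family

Route `DesignFlattening`, crux `GrowingHostDesigns` (stmt-MatrixMultiplication-8033), line `birth`
(tight square host `G_m = ℤ_m × ℤ_m`, kept set `P_m = {b₂ + c₁ = 0}`).  The line's open stub
`stub_canonicalSeparableRate` asks, for every `δ > 0`, for some `m ≥ 2` and a separable `k`-term
toric design of the `N`-th power of the punctured table `T_m = [b + c = a ∧ b₂ + c₁ = 0]` with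
`|ℤ_m²|^N · k < (m^{2+δ})^N`.

This file pins down the LOGICAL POSITION of that stub relative to route `WindowedCompletionRank`:

* `canonicalWindow_of_separableDesign` (the bridge): a separable `k`-term design of `T_m^{⊗N}`
  IS a window-frame completion of `⟨m^N, m^N, m^N⟩` over the host `(ℤ_m²)^N` (Cohn–Umans maps
  `A x = (x, 0)`, `B y = (−y, −y)`, `C z = (0, z)` digitwise) by a tensor `S` of rank `≤ k` — the
  separable completion `S = ∑ⱼ (⊗ᵢ u_{ji}) ⊗ (⊗ᵢ v_{ji}) ⊗ (⊗ᵢ w_{ji})`;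
* `windowCompletion_of_canonicalSeparableRate`: the stub IMPLIES `WindowedCompletionRank.WindowCompletion`
  (stmt-MatrixMultiplication-5495) — with `n = m^N`, `|G| = n²`, `R(S) < n^ε`; so line `birth` is a
  special (separable, `|G| = n²`) case of the crux of line `window-transfer`;
* `canonicalSeparableRate_false_of_windowSqrtBarrier`: `WindowedCompletionRank.WindowSqrtBarrier`
  (stmt-MatrixMultiplication-5493, open, believed) REFUTES the stub: `n³ ≤ |G|·R(S)²` reads
  `m^{3N} ≤ m^{2N} k²`, i.e. `k ≥ m^{N/2}`, incompatible with `k < m^{δN}` at `δ = 1/2`.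

No definitions, no named unproved fact is assumed (both WCR statements appear only as hypotheses /
conclusions of implications).

Sources: Cohn–Umans 2003 (the CU form of a hosting); Coppersmith–Winograd 1990 §11 (toric designs);
ADVXXZ 2025 §3.4 (`⟨q,q,q⟩^{⊗N} ≡ ⟨q^N,q^N,q^N⟩`, tree lemma `matMulTensor_pow_eq_kroneckerPow_comp`).
-/

-- the tree's namespace `Summit.MatrixMultiplication.MatrixMultiplication.…` repeats a component by design
set_option linter.dupNamespace false

namespace Summit.MatrixMultiplication.MatrixMultiplication.Theorems

open scoped BigOperators
open Literature.Computability.AlgebraicComplexity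
open Summit.MatrixMultiplication.MatrixMultiplication.Theses.WindowedCompletionRank

/-- The cast `Fin m → ZMod m` is injective (`ZMod.val_natCast_of_lt`). -/
private theorem fin_cast_zmod_inj {m : ℕ} {i j : Fin m}
    (h : ((i : ℕ) : ZMod m) = ((j : ℕ) : ZMod m)) : i = j := by
  have hv := congrArg ZMod.val h
  rw [ZMod.val_natCast_of_lt i.is_lt, ZMod.val_natCast_of_lt j.is_lt] at hv
  exact Fin.ext hv

/-- The tight square host with EXPLICIT Cohn–Umans maps: for `x = (κ,ν)`, `y = (κ',μ)`, `z = (μ',ν')`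
in `[m]²` (cast into `ZMod m`), `⟨m,m,m⟩(x;y,z) = [(κ'+μ−μ', μ+ν'−μ') = (κ,ν) ∧ μ − μ' = 0]`, the
punctured table `[β y + γ z = α x ∧ (β y)₂ + (γ z)₁ = 0]` at `α x = (κ,ν)`, `β y = (κ'+μ, μ)`,
`γ z = (−μ', ν'−μ')`. -/
private theorem host_explicit (m : ℕ) [NeZero m] (x y z : Fin m × Fin m) :
    matMulTensor ℂ m m m x y z =
      (if ((((y.1 : ℕ) : ZMod m) + ((y.2 : ℕ) : ZMod m)) + (-(((z.1 : ℕ) : ZMod m))) =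
              ((x.1 : ℕ) : ZMod m) ∧
            (((y.2 : ℕ) : ZMod m) + (((z.2 : ℕ) : ZMod m) - ((z.1 : ℕ) : ZMod m))) =
              ((x.2 : ℕ) : ZMod m)) ∧
          ((y.2 : ℕ) : ZMod m) + (-(((z.1 : ℕ) : ZMod m))) = 0
        then (1 : ℂ) else 0) := by
  obtain ⟨κ, ν⟩ := x
  obtain ⟨κ', μ⟩ := y
  obtain ⟨μ', ν'⟩ := z
  simp only [matMulTensor]
  refine if_congr ?_ rfl rfl
  constructor
  · rintro ⟨rfl, rfl, rfl⟩
    exact ⟨⟨by ring, by ring⟩, by ring⟩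
  · rintro ⟨⟨h1, h2⟩, h3⟩
    have hμ : μ = μ' := fin_cast_zmod_inj (by linear_combination h3)
    subst hμ
    exact ⟨fin_cast_zmod_inj (by linear_combination -h1), rfl,
      fin_cast_zmod_inj (by linear_combination -h2)⟩

/-- **The window bridge of the canonical family.**  A separable `k`-term toric design of the `N`-th
power of the punctured table `T_m = [b + c = a ∧ b₂ + c₁ = 0]` over `ℤ_m × ℤ_m` is a window-frame
completion of `⟨m^N, m^N, m^N⟩` over `G = (ℤ_m × ℤ_m)^N`: with the digitwise Cohn–Umans maps
`A x = (x,0)`, `B y = (−y,−y)`, `C z = (0,z)` and the separable completion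
`S = ∑ⱼ (⊗ᵢ u_{ji}) ⊗ (⊗ᵢ v_{ji}) ⊗ (⊗ᵢ w_{ji})` (rank `≤ k`) one has, entrywise,
`⟨m^N,m^N,m^N⟩(a;b,c) = [(A b₁ − B b₂) + (B c₁ + C c₂) = A a₁ + C a₂] · S(A a₁ + C a₂, A b₁ − B b₂, B c₁ + C c₂)`. -/
theorem canonicalWindow_of_separableDesign (m : ℕ) [NeZero m] (N k : ℕ)
    (u v w : Fin k → Fin N → ZMod m × ZMod m → ℂ)
    (h : ∀ a b c : Fin N → ZMod m × ZMod m,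
      kroneckerPow (fun a b c : ZMod m × ZMod m =>
          if b + c = a ∧ (b, c) ∈
              (Finset.univ.filter fun bc : (ZMod m × ZMod m) × (ZMod m × ZMod m) =>
                bc.1.2 + bc.2.1 = 0)
          then (1 : ℂ) else 0) N a b c =
        ∑ j, ∏ i, ((if b i + c i = a i then (1 : ℂ) else 0) *
          u j i (a i) * v j i (b i) * w j i (c i))) :
    ∃ (A B C : Fin (m ^ N) → (Fin N → ZMod m × ZMod m))
      (S : (Fin N → ZMod m × ZMod m) → (Fin N → ZMod m × ZMod m) →
        (Fin N → ZMod m × ZMod m) → ℂ),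
      tensorRank S ≤ k ∧
      matMulTensor ℂ (m ^ N) (m ^ N) (m ^ N) = fun a b c =>
        if (A b.1 - B b.2) + (B c.1 + C c.2) = A a.1 + C a.2
        then S (A a.1 + C a.2) (A b.1 - B b.2) (B c.1 + C c.2) else 0 := by
  -- digits of an index `x : Fin (m^N)`, cast into `ZMod m`
  obtain ⟨d, hd⟩ : ∃ d : Fin (m ^ N) → Fin N → ZMod m,
      d = fun x i => (((finFunctionFinEquiv.symm x) i : ℕ) : ZMod m) := ⟨_, rfl⟩
  -- the separable completion
  obtain ⟨S, hS⟩ : ∃ S : (Fin N → ZMod m × ZMod m) → (Fin N → ZMod m × ZMod m) →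
      (Fin N → ZMod m × ZMod m) → ℂ,
      S = ∑ j, triad (fun a => ∏ i, u j i (a i)) (fun b => ∏ i, v j i (b i))
        (fun c => ∏ i, w j i (c i)) := ⟨_, rfl⟩
  refine ⟨fun x i => (d x i, 0), fun y i => (-(d y i), -(d y i)), fun z i => (0, d z i), S,
    tensorRank_le_of_eq_sum _ _ _ hS, ?_⟩
  funext a b c
  -- the three window arguments, as functions `Fin N → ZMod m × ZMod m`
  have hβ : ((fun i => (d b.1 i, (0 : ZMod m))) - fun i => (-(d b.2 i), -(d b.2 i))) =
      fun i => (d b.1 i + d b.2 i, d b.2 i) := by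
    funext i; simp [sub_eq_add_neg]
  have hγ : ((fun i => (-(d c.1 i), -(d c.1 i))) + fun i => ((0 : ZMod m), d c.2 i)) =
      fun i => (-(d c.1 i), d c.2 i - d c.1 i) := by
    funext i; simp; ring
  have hα : ((fun i => (d a.1 i, (0 : ZMod m))) + fun i => ((0 : ZMod m), d a.2 i)) =
      fun i => (d a.1 i, d a.2 i) := by
    funext i; simp
  simp only []
  rw [hβ, hγ, hα]
  -- the design identity at these arguments
  have hdes := h (fun i => (d a.1 i, d a.2 i)) (fun i => (d b.1 i + d b.2 i, d b.2 i))
    (fun i => (-(d c.1 i), d c.2 i - d c.1 i))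
  -- left-hand side: `⟨m^N⟩ = ⟨m⟩^{⊗N}` digitwise, and each digit copy is the punctured table
  have hL : matMulTensor ℂ (m ^ N) (m ^ N) (m ^ N) a b c =
      kroneckerPow (fun a b c : ZMod m × ZMod m =>
          if b + c = a ∧ (b, c) ∈
              (Finset.univ.filter fun bc : (ZMod m × ZMod m) × (ZMod m × ZMod m) =>
                bc.1.2 + bc.2.1 = 0)
          then (1 : ℂ) else 0) N
        (fun i => (d a.1 i, d a.2 i)) (fun i => (d b.1 i + d b.2 i, d b.2 i))
        (fun i => (-(d c.1 i), d c.2 i - d c.1 i)) := by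
    rw [matMulTensor_pow_eq_kroneckerPow_comp ℂ m m m N]
    simp only [kroneckerPow_apply]
    refine Finset.prod_congr rfl fun i _ => ?_
    rw [host_explicit, hd]
    simp only [Finset.mem_filter, Finset.mem_univ, true_and, Prod.mk_add_mk, Prod.mk.injEq,
      sub_eq_add_neg]
  rw [hL, hdes]
  -- right-hand side: the product of the table indicators is the window indicator
  by_cases hc : ((fun i => (d b.1 i + d b.2 i, d b.2 i)) + fun i => (-(d c.1 i), d c.2 i - d c.1 i)) =
      fun i => (d a.1 i, d a.2 i)
  · rw [if_pos hc]
    have hci : ∀ i, (d b.1 i + d b.2 i, d b.2 i) + (-(d c.1 i), d c.2 i - d c.1 i) =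
        (d a.1 i, d a.2 i) := fun i => by
      have := congrFun hc i
      simpa only [Pi.add_apply] using this
    simp only [hci, if_true, one_mul]
    rw [hS]
    simp only [Finset.sum_apply, triad_apply, Finset.prod_mul_distrib]
  · rw [if_neg hc]
    have hex : ∃ i, ¬ ((d b.1 i + d b.2 i, d b.2 i) + (-(d c.1 i), d c.2 i - d c.1 i) =
        (d a.1 i, d a.2 i)) := by
      by_contra hall
      push Not at hall
      exact hc (funext fun i => by rw [Pi.add_apply]; exact hall i)
    obtain ⟨i, hi⟩ := hex
    refine Finset.sum_eq_zero fun j _ => ?_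
    exact Finset.prod_eq_zero (Finset.mem_univ i) (by rw [if_neg hi]; ring)

/-- **`WindowSqrtBarrier` refutes the stub** (line `birth`): if every window completion obeys
`n³ ≤ |G|·R(S)²` (route `WindowedCompletionRank`, crux `WindowSqrtBarrier`, stmt-5493), then the
canonical family has NO separable design with `|ℤ_m²|^N · k < (m^{2+δ})^N` at `δ = 1/2` — so the body
of `stub_canonicalSeparableRate` (quantified over all `δ > 0`) is false.  Via the bridge: the design
is a window completion of `⟨m^N⟩` over `(ℤ_m²)^N` with `R(S) ≤ k`, so `m^{3N} ≤ m^{2N} k²`, i.e.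
`k ≥ m^{N/2}`, against `k < m^{N/2}`. -/
theorem canonicalSeparableRate_false_of_windowSqrtBarrier (hW : WindowSqrtBarrier) :
    ¬ (∀ δ : ℝ, 0 < δ → ∃ (m : ℕ) (_ : NeZero m), 2 ≤ m ∧
      ∃ (N k : ℕ) (u v w : Fin k → Fin N → ZMod m × ZMod m → ℂ),
        (∀ a b c : Fin N → ZMod m × ZMod m,
          kroneckerPow (fun a b c : ZMod m × ZMod m =>
              if b + c = a ∧ (b, c) ∈
                  (Finset.univ.filter fun bc : (ZMod m × ZMod m) × (ZMod m × ZMod m) =>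
                    bc.1.2 + bc.2.1 = 0)
              then (1 : ℂ) else 0) N a b c =
            ∑ j, ∏ i, ((if b i + c i = a i then (1 : ℂ) else 0) *
              u j i (a i) * v j i (b i) * w j i (c i))) ∧
        (Fintype.card (ZMod m × ZMod m) : ℝ) ^ N * (k : ℝ) < ((m : ℝ) ^ (2 + δ)) ^ N) := by
  intro hCSR
  obtain ⟨m, _, hm, N, k, u, v, w, hdes, hcost⟩ := hCSR (1 / 2) (by norm_num)
  obtain ⟨A, B, C, S, hSk, hwin⟩ := canonicalWindow_of_separableDesign m N k u v w hdes
  -- the barrier: `(m^N)³ ≤ |G| · R(S)²` with `|G| = (m·m)^N`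
  have hbar := hW (m ^ N) (Fin N → ZMod m × ZMod m) A B C S hwin
  have hcard : Fintype.card (Fin N → ZMod m × ZMod m) = (m * m) ^ N := by
    rw [Fintype.card_fun, Fintype.card_prod, ZMod.card, Fintype.card_fin]
  rw [hcard] at hbar
  -- in `ℝ`: `m^{3N} ≤ m^{2N} · k²`
  have hm0 : (0 : ℝ) < m := by exact_mod_cast (zero_lt_two.trans_le hm)
  have h1 : ((m : ℝ) ^ N) ^ 3 ≤ ((m : ℝ) * m) ^ N * (k : ℝ) ^ 2 := by
    have hk : ((tensorRank S : ℕ) : ℝ) ≤ k := by exact_mod_cast hSk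
    calc ((m : ℝ) ^ N) ^ 3 = (((m ^ N) ^ 3 : ℕ) : ℝ) := by push_cast; ring
      _ ≤ (((m * m) ^ N * tensorRank S ^ 2 : ℕ) : ℝ) := by exact_mod_cast hbar
      _ = ((m : ℝ) * m) ^ N * ((tensorRank S : ℕ) : ℝ) ^ 2 := by push_cast; ring
      _ ≤ ((m : ℝ) * m) ^ N * (k : ℝ) ^ 2 := by gcongr
  -- the cost: `m^{2N} · k < (m^{5/2})^N = m^{2N} · (m^{1/2})^N`, so `k² < m^N`
  have hcard1 : (Fintype.card (ZMod m × ZMod m) : ℝ) = (m : ℝ) * m := by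
    rw [Fintype.card_prod, ZMod.card]; push_cast; ring
  rw [hcard1] at hcost
  have hsplit : ((m : ℝ) ^ (2 + (1 / 2 : ℝ))) ^ N = ((m : ℝ) * m) ^ N * ((m : ℝ) ^ (1 / 2 : ℝ)) ^ N := by
    rw [Real.rpow_add hm0, mul_pow]
    congr 2
    rw [show (2 : ℝ) = ((2 : ℕ) : ℝ) by norm_num, Real.rpow_natCast]
    ring
  rw [hsplit] at hcost
  have hpos : (0 : ℝ) < ((m : ℝ) * m) ^ N := by positivity
  have hk : (k : ℝ) < ((m : ℝ) ^ (1 / 2 : ℝ)) ^ N := lt_of_mul_lt_mul_left hcost hpos.le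
  have hk2 : (k : ℝ) ^ 2 < (m : ℝ) ^ N := by
    have hk0 : (0 : ℝ) ≤ k := Nat.cast_nonneg _
    calc (k : ℝ) ^ 2 < (((m : ℝ) ^ (1 / 2 : ℝ)) ^ N) ^ 2 := by gcongr
      _ = (m : ℝ) ^ N := by
          rw [← pow_mul, mul_comm, pow_mul, ← Real.rpow_natCast ((m : ℝ) ^ (1 / 2 : ℝ)) 2,
            ← Real.rpow_mul hm0.le]
          norm_num
  -- contradiction: `m^{3N} ≤ m^{2N} k² < m^{2N} · m^N = m^{3N}`
  have h2 : ((m : ℝ) * m) ^ N * (k : ℝ) ^ 2 < ((m : ℝ) ^ N) ^ 3 := by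
    calc ((m : ℝ) * m) ^ N * (k : ℝ) ^ 2 < ((m : ℝ) * m) ^ N * (m : ℝ) ^ N := by gcongr
      _ = ((m : ℝ) ^ N) ^ 3 := by ring
  exact absurd (h1.trans_lt h2) (lt_irrefl _)

/-- **The stub implies `WindowCompletion`** (line `birth` ⊆ line `window-transfer`): a separable
design of the canonical family with `|ℤ_m²|^N · k < (m^{2+ε})^N` is, via the bridge, a window-frame
completion of `⟨n,n,n⟩`, `n = m^N ≥ 2`, over `G = (ℤ_m²)^N` with `|G| = n² ≤ n^{2+ε}` and
`R(S) ≤ k < m^{εN} = n^ε` — an instance of `WindowedCompletionRank.WindowCompletion` (stmt-5495). -/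
theorem windowCompletion_of_canonicalSeparableRate
    (hCSR : ∀ δ : ℝ, 0 < δ → ∃ (m : ℕ) (_ : NeZero m), 2 ≤ m ∧
      ∃ (N k : ℕ) (u v w : Fin k → Fin N → ZMod m × ZMod m → ℂ),
        (∀ a b c : Fin N → ZMod m × ZMod m,
          kroneckerPow (fun a b c : ZMod m × ZMod m =>
              if b + c = a ∧ (b, c) ∈
                  (Finset.univ.filter fun bc : (ZMod m × ZMod m) × (ZMod m × ZMod m) =>
                    bc.1.2 + bc.2.1 = 0)
              then (1 : ℂ) else 0) N a b c =
            ∑ j, ∏ i, ((if b i + c i = a i then (1 : ℂ) else 0) *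
              u j i (a i) * v j i (b i) * w j i (c i))) ∧
        (Fintype.card (ZMod m × ZMod m) : ℝ) ^ N * (k : ℝ) < ((m : ℝ) ^ (2 + δ)) ^ N) :
    WindowCompletion := by
  intro ε hε
  obtain ⟨m, _, hm, N, k, u, v, w, hdes, hcost⟩ := hCSR ε hε
  obtain ⟨A, B, C, S, hSk, hwin⟩ := canonicalWindow_of_separableDesign m N k u v w hdes
  have hm0 : (0 : ℝ) < m := by exact_mod_cast (zero_lt_two.trans_le hm)
  have hm1 : (1 : ℝ) ≤ m := by exact_mod_cast (one_le_two.trans hm)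
  -- the cost: `m^{2N} · k < m^{2N} · (m^ε)^N`, so `k < (m^N)^ε`
  have hcard1 : (Fintype.card (ZMod m × ZMod m) : ℝ) = (m : ℝ) * m := by
    rw [Fintype.card_prod, ZMod.card]; push_cast; ring
  rw [hcard1] at hcost
  have hsplit : ((m : ℝ) ^ (2 + ε)) ^ N = ((m : ℝ) * m) ^ N * ((m : ℝ) ^ ε) ^ N := by
    rw [Real.rpow_add hm0, mul_pow]
    congr 2
    rw [show (2 : ℝ) = ((2 : ℕ) : ℝ) by norm_num, Real.rpow_natCast]
    ring
  rw [hsplit] at hcost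
  have hpos : (0 : ℝ) < ((m : ℝ) * m) ^ N := by positivity
  have hk : (k : ℝ) < ((m : ℝ) ^ ε) ^ N := lt_of_mul_lt_mul_left hcost hpos.le
  have hkε : (k : ℝ) < (((m ^ N : ℕ) : ℝ)) ^ ε := by
    have hswap : ((m : ℝ) ^ N) ^ ε = ((m : ℝ) ^ ε) ^ N := by
      rw [← Real.rpow_natCast (m : ℝ) N, ← Real.rpow_mul hm0.le, mul_comm, Real.rpow_mul hm0.le,
        Real.rpow_natCast]
    rw [Nat.cast_pow, hswap]
    exact hk
  -- `N ≥ 1`: a `0`-term design of the `0`-th power is impossible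
  have hN : 1 ≤ N := by
    rcases Nat.eq_zero_or_pos N with rfl | hpos'
    · exfalso
      have hk1 : (k : ℝ) < 1 := by simpa using hk
      have hk0 : k = 0 := by exact_mod_cast Nat.lt_one_iff.mp (by exact_mod_cast hk1)
      subst hk0
      have h0 := hdes (fun i => Fin.elim0 i) (fun i => Fin.elim0 i) (fun i => Fin.elim0 i)
      rw [kroneckerPow_zero] at h0
      simp at h0
    · exact hpos'
  -- `n = m^N ≥ 2`
  have hn2 : 2 ≤ m ^ N := by
    calc 2 ≤ m := hm
      _ = m ^ 1 := (pow_one m).symm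
      _ ≤ m ^ N := Nat.pow_le_pow_right (zero_lt_two.trans_le hm) hN
  have hn1 : (1 : ℝ) ≤ ((m ^ N : ℕ) : ℝ) := by exact_mod_cast (one_le_two.trans hn2)
  refine ⟨m ^ N, hn2, (Fin N → ZMod m × ZMod m), inferInstance, inferInstance, inferInstance,
    ?_, A, B, C, S, ?_, hwin⟩
  · -- `|G| = (m·m)^N = n² ≤ n^{2+ε}`
    have hcard : Fintype.card (Fin N → ZMod m × ZMod m) = (m * m) ^ N := by
      rw [Fintype.card_fun, Fintype.card_prod, ZMod.card, Fintype.card_fin]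
    rw [hcard]
    calc (((m * m) ^ N : ℕ) : ℝ) = (((m ^ N : ℕ) : ℝ)) ^ (2 : ℝ) := by
          rw [show (2 : ℝ) = ((2 : ℕ) : ℝ) by norm_num, Real.rpow_natCast]
          push_cast; ring
      _ ≤ (((m ^ N : ℕ) : ℝ)) ^ (2 + ε) :=
          Real.rpow_le_rpow_of_exponent_le hn1 (by linarith)
  · -- `R(S) ≤ k < n^ε`
    have : ((tensorRank S : ℕ) : ℝ) ≤ k := by exact_mod_cast hSk
    exact this.trans hkε.le

end Summit.MatrixMultiplication.MatrixMultiplication.Theorems
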